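import Summits.ValiantsHypothesis.ValiantsHypothesis.Theorems.DefinabilityGapZperTransfer
import HarnessLib

/-!
# DefinabilityGap — the `Z(per)` leaf is FALSE for every `m`: explicit voids (Saha–Saptharishi–Saxena 2009)

Route `route-ValiantsHypothesis-DefinabilityGap`, width ladder of the read-once leaf F4 / W10
(`KIPlantedHittingRO`, stmt-ValiantsHypothesis-23704). The leaf of record `ZperHits₂(m)` = the hypothesis `hZ` of
`DefinabilityGapZperTransfer.chainVal_eq_zero_of_bind₁_kiPer` («`Z(per_m)` hits every width-2 chain of
univariate-image links `M_j(ℓ_j)` with 2-local labels `ℓ_j`, up to multiples, over every field `K ⊇ ℂ`»; census: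
FALSE at `m = 2`, OPEN for `m ≥ 3`) is **FALSE FOR EVERY `m`** — indeed for every locality `c ≥ 1`
(`not_zperHits`), and the same holds with ANY nonzero polynomial `f` in place of `per_m` (`exists_void_of_ne_zero`).

THE VOID (Saha–Saptharishi–Saxena 2009, Lemma 2.1, specialised to single-variable factors): write
`f = Σ_s a_s · ∏ X_i^{s_i}` as a sum of products of 1-local factors. One term `t = [b₁, …, b_d]` is the block
`diag(b₁,1) ⋯ diag(b_d,1) · [[1,1],[0,1]] = [[∏t, ∏t],[0,1]]`; two upper-triangular blocks `[[L₁, L₂·g],[0,L₃]]`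
and `[[M₁, M₂·h],[0,M₃]]` combine through `diag(L₂M₃, L₁M₂)` into
`[[L₁L₂M₁M₃, L₁L₂M₂M₃·(g+h)],[0, L₁L₃M₂M₃]]` (`combine_prod`). Folding over the terms gives a chain of links
`diag(b,1)`, `diag(1,b)`, `[[1,1],[0,1]]` — univariate images `M(b)` with `M ∈ {diag(X,1), diag(1,X), [[1,1],[0,1]]}`
and 1-local labels `b ∈ {a_s, X_i^{e}}` — whose value `(1,0)·∏·(0,1)ᵀ` is `L · f` with `L` a product of the
factors, nonzero over a field (`sss_prod`, `exists_void_of_ne_zero`).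

CONSEQUENCES FOR THE CELL (honest): (1) the `Z(per)`-transfer `chainVal_eq_zero_of_bind₁_kiPer` has an
unsatisfiable hypothesis for every `m` (`not_zperHits_two` is literally `¬ hZ`); (2) the void-structure theorems of
the lineage (unit rigidity, prime rigidity, block census, quadratic `δ`:
`DefinabilityGapSquareRigidity.sq_le_of_void`) are true statements about a NON-EMPTY set — the void above has all
labels 1-local (size is irrelevant here: the right-linear fold below is exponential in `|supp f|`, the balanced fold
of SSS polynomial); (3) the over-quantification is the defect: the transfer consumes `hZ` only on the pushed chart
chains of READ-ONCE block suffixes (`pushLinks m c rest`, blocks pairwise distinct and `≠ c`), which the void is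
not — see the companion file `DefinabilityGapZperTransferRO` for the repaired (read-once) leaf and transfer.
0 S-currency; rung 0; `VP ≠ VNP` untouched.

References: C. Saha, R. Saptharishi, N. Saxena, *The power of depth 2 circuits over algebras*, FSTTCS 2009,
Lemma 2.1 and Cor. 2.2 (width-2 upper-triangular linear ABPs compute `L · f` for every `ΣΠΣ` polynomial `f`)
[cite: SahaSaptharishiSaxena2009, Lemma 2.1]; E. Allender, F. Wang, *On the power of algebraic branching
programs of width two*, Comput. Complexity 25 (2016) (width 2 without the factor `L` is incomplete)
[cite: AllenderWang2016].
-/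

open MvPolynomial Finset
open Literature.Computability.AlgebraicComplexity

namespace Summit.ValiantsHypothesis.ValiantsHypothesis.Theorems.DefinabilityGapZperVoid

open DefinabilityGapZperTransfer

noncomputable section

/-! ## 1. Upper-triangular bookkeeping and the three link shapes -/

/-- The upper-triangular matrix `[[a, b], [0, d]]`. [this file] -/
def ut {R : Type*} [Zero R] (a b d : R) : Matrix (Fin 2) (Fin 2) R := !![a, b; 0, d]

/-- Congruence for `ut`. [this file] -/
theorem ut_congr {R : Type*} [Zero R] {a b d a' b' d' : R} (h₁ : a = a') (h₂ : b = b') (h₃ : d = d') :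
    ut a b d = ut a' b' d' := by
  subst h₁ h₂ h₃
  rfl

/-- Upper-triangular matrices multiply as `[[aa', ab' + bd'],[0, dd']]`. [folklore] -/
theorem ut_mul {R : Type*} [CommSemiring R] (a b d a' b' d' : R) :
    ut a b d * ut a' b' d' = ut (a * a') (a * b' + b * d') (d * d') := by
  ext i j
  fin_cases i <;> fin_cases j <;> simp [ut, Matrix.mul_apply, Fin.sum_univ_two]

/-- The `(0,1)` entry of `ut a b d` is `b`. [this file] -/
theorem ut_apply_zero_one {R : Type*} [Zero R] (a b d : R) : ut a b d 0 1 = b := rfl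

variable {σ K : Type*} [CommSemiring K]

variable (K) in
/-- The univariate matrix `diag(X, 1)`. [this file] -/
def dX1 : Matrix (Fin 2) (Fin 2) (Polynomial K) := !![Polynomial.X, 0; 0, 1]

variable (K) in
/-- The univariate matrix `diag(1, X)`. [this file] -/
def dX2 : Matrix (Fin 2) (Fin 2) (Polynomial K) := !![1, 0; 0, Polynomial.X]

variable (K) in
/-- The constant unipotent matrix `[[1, 1], [0, 1]]`. [this file] -/
def e11 : Matrix (Fin 2) (Fin 2) (Polynomial K) := !![1, 1; 0, 1]

/-- `diag(X,1)(x) = diag(x,1)`. [this file] -/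
theorem ulink_dX1 (x : MvPolynomial σ K) : ulink (dX1 K, x) = ut x 0 1 := by
  ext i j
  fin_cases i <;> fin_cases j <;> simp [ulink, dX1, ut]

/-- `diag(1,X)(x) = diag(1,x)`. [this file] -/
theorem ulink_dX2 (x : MvPolynomial σ K) : ulink (dX2 K, x) = ut 1 0 x := by
  ext i j
  fin_cases i <;> fin_cases j <;> simp [ulink, dX2, ut]

/-- `[[1,1],[0,1]](x) = [[1,1],[0,1]]`. [this file] -/
theorem ulink_e11 (x : MvPolynomial σ K) : ulink (e11 K, x) = ut 1 1 1 := by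
  ext i j
  fin_cases i <;> fin_cases j <;> simp [ulink, e11, ut]

/-- A run of `diag(a,1)` links multiplies to `diag(∏ a, 1)`. [this file] -/
theorem prod_map_dX1 (A : List (MvPolynomial σ K)) :
    ((A.map fun a => (dX1 K, a)).map ulink).prod = ut A.prod 0 1 := by
  induction A with
  | nil =>
    ext i j
    fin_cases i <;> fin_cases j <;> simp [ut]
  | cons a A ih =>
    rw [List.map_cons, List.map_cons, List.prod_cons, ih, ulink_dX1, ut_mul, List.prod_cons]
    exact ut_congr rfl (by simp) (by simp)

/-- A run of `diag(1,a)` links multiplies to `diag(1, ∏ a)`. [this file] -/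
theorem prod_map_dX2 (A : List (MvPolynomial σ K)) :
    ((A.map fun a => (dX2 K, a)).map ulink).prod = ut 1 0 A.prod := by
  induction A with
  | nil =>
    ext i j
    fin_cases i <;> fin_cases j <;> simp [ut]
  | cons a A ih =>
    rw [List.map_cons, List.map_cons, List.prod_cons, ih, ulink_dX2, ut_mul, List.prod_cons]
    exact ut_congr (by simp) (by simp) rfl

/-- The chain value with boundary `(1,0)`, `(0,1)ᵀ` is the `(0,1)` entry of the product. [this file] -/
theorem chainVal_eq_entry (l : List (Matrix (Fin 2) (Fin 2) (MvPolynomial σ K))) :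
    chainVal l ![1, 0] ![0, 1] = l.prod 0 1 := by
  simp [chainVal, Matrix.mulVec, dotProduct, Fin.sum_univ_two]

/-! ## 2. The Saha–Saptharishi–Saxena fold -/

variable (σ K) in
/-- SSS bookkeeping: the links built so far and the factor lists `L1, L2, L3` of the three nonzero entries
`[[∏L1, ∏L2 · g],[0, ∏L3]]` of their product. [cite: SahaSaptharishiSaxena2009, Lemma 2.1] -/
structure Blk where
  /-- the links `(M_j, ℓ_j)` -/
  links : List (Matrix (Fin 2) (Fin 2) (Polynomial K) × MvPolynomial σ K)
  /-- factors of the `(0,0)` entry -/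
  L1 : List (MvPolynomial σ K)
  /-- factors of the cofactor of the `(0,1)` entry -/
  L2 : List (MvPolynomial σ K)
  /-- factors of the `(1,1)` entry -/
  L3 : List (MvPolynomial σ K)

/-- The block of one term `t = [b₁, …, b_d]`:
`diag(b₁,1) ⋯ diag(b_d,1) · [[1,1],[0,1]] = [[∏t, ∏t],[0,1]]`.
[cite: SahaSaptharishiSaxena2009, Lemma 2.1] -/
def termBlk (t : List (MvPolynomial σ K)) : Blk σ K :=
  ⟨(t.map fun a => (dX1 K, a)) ++ [(e11 K, 0)], t, [], []⟩

/-- The SSS combination of two blocks: `B · diag(L₂M₃, L₁M₂) · B'`.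
[cite: SahaSaptharishiSaxena2009, Lemma 2.1] -/
def combine (b b' : Blk σ K) : Blk σ K :=
  ⟨b.links ++ ((b.L2 ++ b'.L3).map fun a => (dX1 K, a)) ++ ((b.L1 ++ b'.L2).map fun a => (dX2 K, a)) ++ b'.links,
    b.L1 ++ b.L2 ++ (b'.L1 ++ b'.L3), b.L1 ++ b.L2 ++ (b'.L2 ++ b'.L3), b.L1 ++ b.L3 ++ (b'.L2 ++ b'.L3)⟩

/-- The SSS chain of a sum of products, one block per term, folded from the right.
[cite: SahaSaptharishiSaxena2009, Lemma 2.1] -/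
def sss : List (List (MvPolynomial σ K)) → Blk σ K
  | [] => termBlk []
  | [t] => termBlk t
  | t :: t' :: T => combine (termBlk t) (sss (t' :: T))

/-- The term block computes `[[∏t, ∏t],[0,1]]`. [this file] -/
theorem termBlk_prod (t : List (MvPolynomial σ K)) :
    ((termBlk t).links.map ulink).prod =
      ut (termBlk t).L1.prod ((termBlk t).L2.prod * t.prod) (termBlk t).L3.prod := by
  simp only [termBlk, List.map_append, List.map_cons, List.map_nil, List.prod_append, List.prod_cons,
    List.prod_nil, mul_one, prod_map_dX1, ulink_e11, ut_mul]
  exact ut_congr (by ring) (by ring) (by ring)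

/-- THE COMBINATION STEP: `[[L₁, L₂g],[0,L₃]] · diag(L₂M₃, L₁M₂) · [[M₁, M₂h],[0,M₃]] =
[[L₁L₂M₁M₃, L₁L₂M₂M₃(g+h)],[0, L₁L₃M₂M₃]]`. [cite: SahaSaptharishiSaxena2009, Lemma 2.1] -/
theorem combine_prod (b b' : Blk σ K) (g h : MvPolynomial σ K)
    (hb : (b.links.map ulink).prod = ut b.L1.prod (b.L2.prod * g) b.L3.prod)
    (hb' : (b'.links.map ulink).prod = ut b'.L1.prod (b'.L2.prod * h) b'.L3.prod) :
    ((combine b b').links.map ulink).prod =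
      ut (combine b b').L1.prod ((combine b b').L2.prod * (g + h)) (combine b b').L3.prod := by
  simp only [combine, List.map_append, List.prod_append, hb, hb', prod_map_dX1, prod_map_dX2, ut_mul]
  exact ut_congr (by ring) (by ring) (by ring)

/-- **SSS, Lemma 2.1** (value): the SSS chain of `T = [t₁, …, t_s]` computes
`[[∏L1, ∏L2 · Σ_i ∏t_i],[0, ∏L3]]`.
[cite: SahaSaptharishiSaxena2009, Lemma 2.1] -/
theorem sss_prod : ∀ T : List (List (MvPolynomial σ K)), T ≠ [] →
    ((sss T).links.map ulink).prod =
      ut (sss T).L1.prod ((sss T).L2.prod * (T.map List.prod).sum) (sss T).L3.prod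
  | [], hT => absurd rfl hT
  | [t], _ => by
    simp only [sss, List.map_cons, List.map_nil, List.sum_cons, List.sum_nil, add_zero]
    exact termBlk_prod t
  | t :: t' :: T, _ => by
    simp only [sss, List.map_cons, List.sum_cons]
    have ih := sss_prod (t' :: T) (List.cons_ne_nil _ _)
    rw [List.map_cons, List.sum_cons] at ih
    exact combine_prod _ _ _ _ (termBlk_prod t) ih

/-- The factor lists of the SSS chain consist of factors of the terms. [this file] -/
theorem sss_factors {P : MvPolynomial σ K → Prop} :
    ∀ T : List (List (MvPolynomial σ K)), (∀ t ∈ T, ∀ a ∈ t, P a) →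
      ∀ a ∈ (sss T).L1 ++ (sss T).L2 ++ (sss T).L3, P a
  | [], _ => by simp [sss, termBlk]
  | [t], hT => by
    simp only [sss, termBlk, List.append_nil]
    exact hT t (List.mem_singleton_self t)
  | t :: t' :: T, hT => by
    have ih := sss_factors (P := P) (t' :: T) fun s hs => hT s (List.mem_cons_of_mem t hs)
    have ht := hT t (List.mem_cons_self ..)
    simp only [sss, combine, termBlk, List.forall_mem_append] at ih ⊢
    tauto

/-- The labels of the SSS chain are factors of the terms or the constant `0`. [this file] -/
theorem sss_labels {P : MvPolynomial σ K → Prop} (h0 : P 0) :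
    ∀ T : List (List (MvPolynomial σ K)), (∀ t ∈ T, ∀ a ∈ t, P a) → ∀ e ∈ (sss T).links, P e.2
  | [], _ => by simpa [sss, termBlk] using h0
  | [t], hT => by
    intro e he
    rcases List.mem_append.1 he with he | he
    · obtain ⟨a, ha, rfl⟩ := List.mem_map.1 he
      exact hT t (List.mem_singleton_self t) a ha
    · rw [(List.mem_singleton.1 he : e = (e11 K, 0))]
      exact h0
  | t :: t' :: T, hT => by
    have hT' : ∀ s ∈ t' :: T, ∀ a ∈ s, P a := fun s hs => hT s (List.mem_cons_of_mem t hs)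
    have ih := sss_labels h0 (t' :: T) hT'
    have ihf := sss_factors (P := P) (t' :: T) hT'
    have ht := hT t (List.mem_cons_self ..)
    simp only [sss, combine, termBlk, List.forall_mem_append, List.forall_mem_map, List.forall_mem_cons] at ih ihf ⊢
    tauto

/-- The matrices of the SSS chain are `diag(X,1)`, `diag(1,X)` or `[[1,1],[0,1]]`. [this file] -/
theorem sss_shapes : ∀ (T : List (List (MvPolynomial σ K))), ∀ e ∈ (sss T).links,
    e.1 = dX1 K ∨ e.1 = dX2 K ∨ e.1 = e11 K
  | [], e, he => by
    simp only [sss, termBlk, List.map_nil, List.nil_append, List.mem_singleton] at he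
    exact Or.inr (Or.inr (by rw [he]))
  | [t], e, he => by
    simp only [sss, termBlk, List.mem_append, List.mem_map, List.mem_singleton] at he
    rcases he with ⟨a, -, rfl⟩ | rfl
    · exact Or.inl rfl
    · exact Or.inr (Or.inr rfl)
  | t :: t' :: T, e, he => by
    simp only [sss, combine, termBlk, List.mem_append, List.mem_map, List.mem_singleton] at he
    rcases he with (((⟨a, -, rfl⟩ | rfl) | ⟨a, -, rfl⟩) | ⟨a, -, rfl⟩) | he
    · exact Or.inl rfl
    · exact Or.inr (Or.inr rfl)
    · exact Or.inl rfl
    · exact Or.inr (Or.inl rfl)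
    · exact sss_shapes (t' :: T) e he

/-- **SSS, Lemma 2.1** (packaged): every sum of products `Σ_i ∏ t_i` is, up to a factor `L` that is a product of
factors of the terms, the value `(1,0) · ∏_j M_j(ℓ_j) · (0,1)ᵀ` of a width-2 chain of univariate images whose labels
are factors of the terms or `0` and whose matrices are `diag(X,1)`, `diag(1,X)`, `[[1,1],[0,1]]`.
[cite: SahaSaptharishiSaxena2009, Lemma 2.1] -/
theorem exists_chain_eq_mul_sum_prod (T : List (List (MvPolynomial σ K))) (hT : T ≠ []) :
    ∃ l : List (Matrix (Fin 2) (Fin 2) (Polynomial K) × MvPolynomial σ K),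
      (∀ e ∈ l, (e.1 = dX1 K ∨ e.1 = dX2 K ∨ e.1 = e11 K) ∧ (e.2 = 0 ∨ ∃ t ∈ T, e.2 ∈ t)) ∧
      ∃ L : List (MvPolynomial σ K), (∀ a ∈ L, ∃ t ∈ T, a ∈ t) ∧
        chainVal (l.map ulink) ![1, 0] ![0, 1] = L.prod * (T.map List.prod).sum := by
  refine ⟨(sss T).links, fun e he => ⟨?_, ?_⟩, (sss T).L2, fun a ha => ?_, ?_⟩
  · exact sss_shapes T e he
  · exact sss_labels (P := fun a => a = 0 ∨ ∃ t ∈ T, a ∈ t) (Or.inl rfl) T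
      (fun t ht a ha => Or.inr ⟨t, ht, ha⟩) e he
  · exact sss_factors (P := fun a => ∃ t ∈ T, a ∈ t) T (fun t ht a ha => ⟨t, ht, ha⟩) a
      (by simp only [List.mem_append]; exact Or.inl (Or.inr ha))
  · rw [chainVal_eq_entry, sss_prod T hT, ut_apply_zero_one]

/-! ## 3. A void for every nonzero polynomial -/

/-- The 1-local terms of `f`: one list `[C a_s, X_{i₁}^{s i₁}, …]` per monomial `s ∈ supp f`. [this file] -/
def monTerms (f : MvPolynomial σ K) : List (List (MvPolynomial σ K)) :=
  f.support.toList.map fun s => C (coeff s f) :: s.support.toList.map fun i => X i ^ s i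

/-- The terms of `f` sum to `f`. [this file] -/
theorem sum_monTerms (f : MvPolynomial σ K) : ((monTerms f).map List.prod).sum = f := by
  conv_rhs => rw [← support_sum_monomial_coeff f]
  rw [monTerms, List.map_map, Finset.sum_map_toList]
  refine Finset.sum_congr rfl fun s _ => ?_
  rw [Function.comp_apply, List.prod_cons, Finset.prod_map_toList, monomial_eq]
  rfl

/-- `f ≠ 0` has at least one term. [this file] -/
theorem monTerms_ne_nil {f : MvPolynomial σ K} (hf : f ≠ 0) : monTerms f ≠ [] := by
  intro h
  rw [monTerms, List.map_eq_nil_iff, Finset.toList_eq_nil, support_eq_empty] at h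
  exact hf h

/-- Every factor of a term of `f` is 1-local. [this file] -/
theorem monTerms_local [Nontrivial K] (f : MvPolynomial σ K) :
    ∀ t ∈ monTerms f, ∀ a ∈ t, ∃ S : Finset σ, S.card ≤ 1 ∧ a.vars ⊆ S := by
  intro t ht a ha
  obtain ⟨s, -, rfl⟩ := List.mem_map.1 ht
  rcases List.mem_cons.1 ha with rfl | ha
  · exact ⟨∅, by simp, by rw [vars_C]⟩
  · obtain ⟨i, -, rfl⟩ := List.mem_map.1 ha
    exact ⟨{i}, by simp, (vars_pow _ _).trans (by rw [vars_X])⟩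

/-- Over a field, every factor of a term of `f` is nonzero. [this file] -/
theorem monTerms_ne_zero {F : Type*} [Field F] (f : MvPolynomial σ F) :
    ∀ t ∈ monTerms f, ∀ a ∈ t, a ≠ 0 := by
  intro t ht a ha
  obtain ⟨s, hs, rfl⟩ := List.mem_map.1 ht
  rcases List.mem_cons.1 ha with rfl | ha
  · exact C_eq_zero.not.2 (mem_support_iff.1 (Finset.mem_toList.1 hs))
  · obtain ⟨i, -, rfl⟩ := List.mem_map.1 ha
    exact pow_ne_zero _ (X_ne_zero i)

/-- **A VOID FOR EVERY NONZERO `f`** (KERNEL; SSS 2009 on the monomial expansion): over a field, some width-2 chain of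
univariate-image links with 1-LOCAL labels computes a NONZERO multiple `f · H` of `f`, with boundary `(1,0)`, `(0,1)ᵀ`.
Hence no statement «`Z(f)` hits the `c`-local univariate-image width-2 chains up to multiples» (`c ≥ 1`) holds.
[cite: SahaSaptharishiSaxena2009, Lemma 2.1] -/
theorem exists_void_of_ne_zero {F : Type*} [Field F] (f : MvPolynomial σ F) (hf : f ≠ 0) :
    ∃ l : List (Matrix (Fin 2) (Fin 2) (Polynomial F) × MvPolynomial σ F),
      (∀ e ∈ l, ∃ S : Finset σ, S.card ≤ 1 ∧ e.2.vars ⊆ S) ∧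
      ∃ H : MvPolynomial σ F, H ≠ 0 ∧ chainVal (l.map ulink) ![1, 0] ![0, 1] = f * H := by
  obtain ⟨l, hl, L, hL, hval⟩ := exists_chain_eq_mul_sum_prod (monTerms f) (monTerms_ne_nil hf)
  refine ⟨l, fun e he => ?_, L.prod, ?_, ?_⟩
  · rcases (hl e he).2 with h0 | ⟨t, ht, h⟩
    · exact ⟨∅, by simp, by rw [h0, vars_0]⟩
    · exact monTerms_local f t ht e.2 h
  · refine List.prod_ne_zero fun h0 => ?_
    obtain ⟨t, ht, h⟩ := hL 0 h0
    exact monTerms_ne_zero f t ht 0 h rfl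
  · rw [hval, sum_monTerms, mul_comm]

/-! ## 4. The leaf of record is false for every `m` -/

/-- **`ZperHits_c(m)` IS FALSE FOR EVERY `m` AND EVERY LOCALITY `c ≥ 1`** (KERNEL refutation of the leaf of record of
the `Z(per)` transfer; the census had FALSE at `m = 2`, OPEN for `m ≥ 3`). Witness: the SSS void of `per_m` over `ℂ`.
[cite: SahaSaptharishiSaxena2009, Lemma 2.1] -/
theorem not_zperHits (m c : ℕ) (hc : 1 ≤ c) : ¬ ∀ (K : Type) [Field K] [Algebra ℂ K]
      (l : List (Matrix (Fin 2) (Fin 2) (Polynomial K) × MvPolynomial (Fin m × Fin m) K)),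
      (∀ e ∈ l, ∃ S : Finset (Fin m × Fin m), S.card ≤ c ∧ e.2.vars ⊆ S) →
      ∀ (u v : Fin 2 → K) (H : MvPolynomial (Fin m × Fin m) K),
        chainVal (l.map ulink) u v = perPoly (Fin m) K * H → chainVal (l.map ulink) u v = 0 := by
  intro hZ
  obtain ⟨l, hloc, H, hH, hval⟩ := exists_void_of_ne_zero (perPoly (Fin m) ℂ) (perPoly_ne_zero (Fin m) ℂ)
  have h0 := hZ ℂ l (fun e he => (hloc e he).imp fun S hS => ⟨hS.1.trans hc, hS.2⟩) ![1, 0] ![0, 1] H hval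
  rw [hval] at h0
  exact mul_ne_zero (perPoly_ne_zero (Fin m) ℂ) hH h0

/-- **THE LEAF `ZperHits₂(m)` OF THE TRANSFER IS FALSE FOR EVERY `m`**: literally `¬ hZ` for the hypothesis `hZ` of
`DefinabilityGapZperTransfer.chainVal_eq_zero_of_bind₁_kiPer` / `kiPer_hits_isROABP_two` (at `m = 2` this is
`zperHits_two_fails`, by a different chain). [cite: SahaSaptharishiSaxena2009, Lemma 2.1] -/
theorem not_zperHits_two (m : ℕ) : ¬ ∀ (K : Type) [Field K] [Algebra ℂ K]
      (l : List (Matrix (Fin 2) (Fin 2) (Polynomial K) × MvPolynomial (Fin m × Fin m) K)),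
      (∀ e ∈ l, ∃ S : Finset (Fin m × Fin m), S.card ≤ 2 ∧ e.2.vars ⊆ S) →
      ∀ (u v : Fin 2 → K) (H : MvPolynomial (Fin m × Fin m) K),
        chainVal (l.map ulink) u v = perPoly (Fin m) K * H → chainVal (l.map ulink) u v = 0 :=
  not_zperHits m 2 (by norm_num)

end

end Summit.ValiantsHypothesis.ValiantsHypothesis.Theorems.DefinabilityGapZperVoid
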